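import Literature.MathematicalPhysics.QuantumFieldTheory.Balaban1983to89.B9SectBStepFrameV6
import Literature.MathematicalPhysics.QuantumFieldTheory.Balaban1983to89.B9SectBH1GStepAtLetters
import Literature.MathematicalPhysics.QuantumFieldTheory.Balaban1983to89.B9SectBE4H2GStepAtLetters

/-!
# `Balaban1983to89.B9SectBStepFrameV7` — THE LETTERS-LEVEL SECT.-B STEP FRAME, VERSION 7: `SectBFrame₇` + ★★ `sectBStepPrinted_of_sectBFrame₇`;
# = `SectBFrame₆` (p543029) with ALL THREE Hölder ∕ sup block-steps (3.43)–(3.45) of G(U′U) TAKEN OFF THE DISPLAYED LIST — they are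
# `B9SectBH1GStepAtLetters.stepH1Pos_of_h1GFrame₂` and `B9SectBE4H2GStepAtLetters.stepE4Pos_of_e4h2GFrame₂` ∕ `stepH2Pos_of_e4h2GFrame₂` on the
# kernel-free Hölder dictionaries `H1GFrame₂`, `E4H2GFrame₂`; NO Sect.-B member-step is displayed any more: every one of the 2 × 10 block-steps of
# `B9SectBStepWhole` for G′(U′U) and G(U′U) is a theorem on the letters

T. Bałaban, *Propagators for lattice gauge theories in a background field*, Commun. Math. Phys. **99** (1985) 389–434
[`Balaban1985BackgroundPropagators`, "B9"], Sect. B pp. 400–407 (Theorem 3.4); Theorem 3.3 p. 399; (3.43)–(3.45) p. 398; [4] = T. Bałaban,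
*Propagators and renormalization transformations for lattice gauge theories. II*, Commun. Math. Phys. **96** (1984) 223–250 [`Balaban1984PropagatorsII`].

statement-level skeleton of published theorems with citation tags; proofs where landed; nothing here is a claim about the Yang–Mills mass gap

WHY (pub-ymgap N06 row 13, seat dag-n06-c gen 6; `GSIDE-L2-SPEC.md` §G).  `SectBFrame₆` displayed the three Hölder ∕ sup member-steps (3.43)–(3.45) of
G(U′U) because r06's G-side Hölder chain consumed kernel-form letters of G(U) (lit-balaban desk ME #13: vacuous on multi-point blocks).  This lineage's
g6 files `B9SectBGHolderLeftAtLetters` (the entry clauses of the family's G(U′U) at the letters), `B9Thm34POneUniformR1` + `B9Thm34HolderGClauseUniformR1`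
+ `B9Thm34HolderInputGClauseUniformR1` (r06 FILES 55 ∕ 57-G re-run on the kernel-free clause `B9Thm34GUniformR1.thm34_G_clause_uniform`) and
`B9SectBH1GStepAtLetters` (`H1GFrame₂`, ★ `stepH1Pos_of_h1GFrame₂`) ∕ `B9SectBE4H2GStepAtLetters` (`E4H2GFrame₂`, ★ `stepE4Pos_of_e4h2GFrame₂`, ★
`stepH2Pos_of_e4h2GFrame₂`) make (3.43)–(3.45) of G(U′U) theorems on the letters.  `SectBFrame₇` swaps the two dictionaries in and drops `stepH1G`,
`stepE4G`, `stepH2G`; `SectBFrame₇.toSectBFrame₆` shows v7 ⇒ v6.  What an INSTANCE owes is now exclusively dictionary content (letters, their laws,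
readings ∕ writings of the family's norms (3.40)–(3.47) as block ∕ block-ℓ² ∕ probe statements) — node00-def-Y ∕ dag-n06-d business.

WHAT IS IN THE FILE (0 sorry; standard axioms): `structure SectBFrame₇ … extends GlobGFrame₂, AnGFrame₂, GlobFrame₂, H1Frame₂, E4H2Frame₂, AnFrame₂, L2GFrame₃,
H1GFrame₂, E4H2GFrame₂` (+ `readL2_3 … writeL2_5` as v4–v6; NO displayed step); `SectBFrame₇.toSectBFrame₆` (`stepH1G`, `stepE4G`, `stepH2G` := the three
kernel-free step theorems at the frame's Lemma-2.1 datum); ★★ `sectBStepPrinted_of_sectBFrame₇`.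

HONEST SCOPE.  Hypothesis structures, NOT shown inhabited (instance = node00-def-Y ∕ dag-n06-d business: the Hölder quotients (3.40) of bond functions on
the pinned carriers as probes, besides everything `SectBFrame₆` asks); NO Sect.-B step is displayed; the frame's fields are hypotheses an instance must meet.  Nothing of [B9] asserted; N06 NOT discharged; count-neutral; nothing continuum ∕
OS ∕ mass-gap ∕ Clay.  Cell `pub-ymgap` (HUMAN RULING D-0062), Track A node N06 [B9], N06-ASSIGNMENT row 13, 2026-08-27.

RELATED IN THE TREE, NOT DUPLICATED: `B9SectBStepFrameV6` (`SectBFrame₆`, `sectBStepPrinted_of_sectBFrame₆`), `B9SectBStepFrameV5`, `B9SectBH1GStepAtLetters`, `B9SectBE4H2GStepAtLetters`,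
`B9SectBGpStepAtLettersV2`, `B9SectBGStepAtLettersV2`, `B9SectBL2GStepAtLettersV3` — USED BY NAME; no existing module modified.
-/

noncomputable section

namespace Literature.MathematicalPhysics.QuantumFieldTheory.Balaban1983to89.B9SectBStepFrameV7

open Literature.MathematicalPhysics.QuantumFieldTheory.Balaban1983to89
open Literature.MathematicalPhysics.QuantumFieldTheory.Balaban1983to89.B6RandomWalkL2 (HasL2Majorant)
open Literature.MathematicalPhysics.QuantumFieldTheory.Balaban1983to89.B9Thm34Ext (toB6)
open Literature.MathematicalPhysics.QuantumFieldTheory.Balaban1983to89.B9Eq352DivFormLetters (conj)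
open Literature.MathematicalPhysics.QuantumFieldTheory.Balaban1983to89.B9Eq352GradLetters (diffLetter)
open Literature.MathematicalPhysics.QuantumFieldTheory.Balaban1983to89.B9FromB6 (L2Block)
open Literature.MathematicalPhysics.QuantumFieldTheory.Balaban1983to89.B9SectBGpStepAtLettersV2 (GpFrame₂ GlobFrame₂ H1Frame₂ E4H2Frame₂ AnFrame₂)
open Literature.MathematicalPhysics.QuantumFieldTheory.Balaban1983to89.B9SectBGStepAtLettersV2 (GFrame₂ GlobGFrame₂ AnGFrame₂)
open Literature.MathematicalPhysics.QuantumFieldTheory.Balaban1983to89.B9SectBStepFrameV6 (SectBFrame₆ sectBStepPrinted_of_sectBFrame₆)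
open Literature.MathematicalPhysics.QuantumFieldTheory.Balaban1983to89.B9SectBH1GStepAtLetters (H1GFrame₂ stepH1Pos_of_h1GFrame₂)
open Literature.MathematicalPhysics.QuantumFieldTheory.Balaban1983to89.B9SectBE4H2GStepAtLetters (E4H2GFrame₂ stepE4Pos_of_e4h2GFrame₂ stepH2Pos_of_e4h2GFrame₂)
open Literature.MathematicalPhysics.QuantumFieldTheory.Balaban1983to89.B9SectBL2GStepAtLettersV3 (L2GFrame₃)

universe u

variable {I : Type} (c35 : ℝ) (geo : I → B9.Geometry) (bg : I → B9.Backgrounds)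
  (Gp : ∀ i, B9.KernelFamily (geo i) (bg i))
  {𝔸 : Type u} [NormedRing 𝔸] [NormedAlgebra ℂ 𝔸] [CompleteSpace 𝔸] {ι : Type} [Fintype ι] [DecidableEq ι]
  (b : Module.Basis ι ℝ 𝔸) (κ : Type) [Fintype κ] [LinearOrder κ]
  (S : I → Type) [∀ i, Fintype (S i)] [∀ i, DecidableEq (S i)]
  [∀ i, Fintype (geo i).Site] [∀ i, DecidableEq (geo i).Site] [∀ i, Nonempty (geo i).Site]

/-- **THE WHOLE SECT.-B LETTERS DICTIONARY, V7** — `SectBFrame₆` with the kernel-free Hölder dictionaries `H1GFrame₂`, `E4H2GFrame₂` of G swapped in and the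
three block-steps (3.43)–(3.45) of G(U′U) dropped from the displayed list (they are `stepH1Pos_of_h1GFrame₂`, `stepE4Pos_of_e4h2GFrame₂`,
`stepH2Pos_of_e4h2GFrame₂`); NO Sect.-B step displayed.  A hypothesis structure; nothing asserted.
[cite: Balaban1985BackgroundPropagators, Thm 3.4 p.400 + Sect. B pp.400–407 + Thm 3.1 (3.43)–(3.46) p.398 + Thm 3.3 p.399 + p.403 l.1–9 + p.407] -/
structure SectBFrame₇ (GA : ∀ i, B9.KernelFamily (geo i) (bg i)) (Cinv : ∀ i, B9.SiteKernel (geo i) (bg i))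
    (IsAnalyticExt : ∀ i, B9.KernelFamily (geo i) (bg i) → (bg i).Cfg → ℝ → Prop)
    extends GlobGFrame₂ c35 geo bg Gp b κ S GA Cinv, AnGFrame₂ c35 geo bg Gp b κ S GA Cinv IsAnalyticExt,
      GlobFrame₂ c35 geo bg Gp b κ S, H1Frame₂ c35 geo bg Gp b κ S, E4H2Frame₂ c35 geo bg Gp b κ S,
      AnFrame₂ c35 geo bg Gp b κ S IsAnalyticExt, L2GFrame₃ c35 geo bg Gp b κ S GA Cinv, H1GFrame₂ c35 geo bg Gp b κ S GA Cinv,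
      E4H2GFrame₂ c35 geo bg Gp b κ S GA Cinv where
  /-- READING (3.46)₃ at U per PAIR of concrete difference letters: `∇_k∇_lG′(U) ≺₂ cL·B₀·1·e^{−δd}`. -/
  readL2_3 : ∀ i (α₀ : ℝ) (U : (bg i).Cfg) (B₀ δ : ℝ), MInv ≤ (geo i).M → 0 < α₀ → (geo i).M * α₀ ≤ aInv →
    (bg i).Reg335 c35 α₀ U → 0 < B₀ → 0 < δ → L2Block (Gp i) B₀ δ U →
    ∀ k l : κ ⊕ κ, HasL2Majorant (g := toB6 (geo i) (Rr i) (Hp i)) (fun p : S i × ι => blk i p.1)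
      (conj b (diffLetter (T i) (coord i U) ((((geo i).eta : ℂ))⁻¹) k) *
        conj b (diffLetter (T i) (coord i U) ((((geo i).eta : ℂ))⁻¹) l) * Gop i U)
      (fun a a' => cL * B₀ * 1 * Real.exp (-(δ * (geo i).dist a a')))
  /-- WRITING (3.46)₃ at U′U from block-ℓ² majorants of every `∇_k∇_lG′(U′U)` (letters at the real U). -/
  writeL2_3 : ∀ i (U U' : (bg i).Cfg) (α₁ B δ : ℝ), 0 < α₁ → α₁ ≤ aW → (bg i).Cplx337 α₁ U U' → 0 ≤ B → 0 < δ →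
    (∀ k l : κ ⊕ κ, HasL2Majorant (g := toB6 (geo i) (Rr i) (Hp i)) (fun p : S i × ι => blk i p.1)
        (conj b (diffLetter (T i) (coord i U) ((((geo i).eta : ℂ))⁻¹) k) *
          conj b (diffLetter (T i) (coord i U) ((((geo i).eta : ℂ))⁻¹) l) * Gop i ((bg i).mul U' U))
        (fun a a' => B * 1 * Real.exp (-(δ * (geo i).dist a a')))) →
    ∀ (lam : (geo i).Loc) (h : (geo i).Cut) (y y' : (geo i).Site), (geo i).cutIn h y → (geo i).suppIn lam y' →
      (Gp i).l2 3 ((bg i).mul U' U) lam h ≤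
        wL B δ * B9.pref6 ((geo i).len y) 3 * (geo i).cutSup h * Real.exp (-(wLδ δ * (geo i).dist y y')) * (geo i).l2Norm lam
  /-- READING of the mixed member (3.46)₄ at U per pair of concrete difference letters. -/
  readL2_4 : ∀ i (α₀ : ℝ) (U : (bg i).Cfg) (B₀ δ : ℝ), MInv ≤ (geo i).M → 0 < α₀ → (geo i).M * α₀ ≤ aInv →
    (bg i).Reg335 c35 α₀ U → 0 < B₀ → 0 < δ → L2Block (Gp i) B₀ δ U →
    ∀ k l : κ ⊕ κ, HasL2Majorant (g := toB6 (geo i) (Rr i) (Hp i)) (fun p : S i × ι => blk i p.1)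
      (conj b (diffLetter (T i) (coord i U) ((((geo i).eta : ℂ))⁻¹) k) * Gop i U *
        conj b (diffLetter (T i) (coord i U) ((((geo i).eta : ℂ))⁻¹) l))
      (fun a a' => cL * B₀ * 1 * Real.exp (-(δ * (geo i).dist a a')))
  /-- WRITING of the mixed member (3.46)₄ at U′U from block-ℓ² majorants of every `∇_kG′(U′U)∇♯_l`. -/
  writeL2_4 : ∀ i (U U' : (bg i).Cfg) (α₁ B δ : ℝ), 0 < α₁ → α₁ ≤ aW → (bg i).Cplx337 α₁ U U' → 0 ≤ B → 0 < δ →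
    (∀ k l : κ ⊕ κ, HasL2Majorant (g := toB6 (geo i) (Rr i) (Hp i)) (fun p : S i × ι => blk i p.1)
        (conj b (diffLetter (T i) (coord i U) ((((geo i).eta : ℂ))⁻¹) k) * Gop i ((bg i).mul U' U) *
          conj b (diffLetter (T i) (coord i U) ((((geo i).eta : ℂ))⁻¹) l))
        (fun a a' => B * 1 * Real.exp (-(δ * (geo i).dist a a')))) →
    ∀ (lam : (geo i).Loc) (h : (geo i).Cut) (y y' : (geo i).Site), (geo i).cutIn h y → (geo i).suppIn lam y' →
      (Gp i).l2 4 ((bg i).mul U' U) lam h ≤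
        wL B δ * B9.pref6 ((geo i).len y) 4 * (geo i).cutSup h * Real.exp (-(wLδ δ * (geo i).dist y y')) * (geo i).l2Norm lam
  /-- READING (3.46)₅ at U per PAIR of concrete difference letters: `G′(U)∇♯_k∇♯_l ≺₂ cL·B₀·1·e^{−δd}`. -/
  readL2_5 : ∀ i (α₀ : ℝ) (U : (bg i).Cfg) (B₀ δ : ℝ), MInv ≤ (geo i).M → 0 < α₀ → (geo i).M * α₀ ≤ aInv →
    (bg i).Reg335 c35 α₀ U → 0 < B₀ → 0 < δ → L2Block (Gp i) B₀ δ U →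
    ∀ k l : κ ⊕ κ, HasL2Majorant (g := toB6 (geo i) (Rr i) (Hp i)) (fun p : S i × ι => blk i p.1)
      (Gop i U * conj b (diffLetter (T i) (coord i U) ((((geo i).eta : ℂ))⁻¹) k) *
        conj b (diffLetter (T i) (coord i U) ((((geo i).eta : ℂ))⁻¹) l))
      (fun a a' => cL * B₀ * 1 * Real.exp (-(δ * (geo i).dist a a')))
  /-- WRITING (3.46)₅ at U′U from block-ℓ² majorants of every `G′(U′U)∇♯_k∇♯_l` (letters at the real U). -/
  writeL2_5 : ∀ i (U U' : (bg i).Cfg) (α₁ B δ : ℝ), 0 < α₁ → α₁ ≤ aW → (bg i).Cplx337 α₁ U U' → 0 ≤ B → 0 < δ →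
    (∀ k l : κ ⊕ κ, HasL2Majorant (g := toB6 (geo i) (Rr i) (Hp i)) (fun p : S i × ι => blk i p.1)
        (Gop i ((bg i).mul U' U) * conj b (diffLetter (T i) (coord i U) ((((geo i).eta : ℂ))⁻¹) k) *
          conj b (diffLetter (T i) (coord i U) ((((geo i).eta : ℂ))⁻¹) l))
        (fun a a' => B * 1 * Real.exp (-(δ * (geo i).dist a a')))) →
    ∀ (lam : (geo i).Loc) (h : (geo i).Cut) (y y' : (geo i).Site), (geo i).cutIn h y → (geo i).suppIn lam y' →
      (Gp i).l2 5 ((bg i).mul U' U) lam h ≤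
        wL B δ * B9.pref6 ((geo i).len y) 5 * (geo i).cutSup h * Real.exp (-(wLδ δ * (geo i).dist y y')) * (geo i).l2Norm lam

variable {c35 geo bg Gp b κ S}

/-- **v7 ⇒ v6**: a `SectBFrame₇` yields a `SectBFrame₆` whose displayed (3.43)–(3.45) steps of G(U′U) are filled by
`B9SectBH1GStepAtLetters.stepH1Pos_of_h1GFrame₂` and `B9SectBE4H2GStepAtLetters.stepE4Pos_of_e4h2GFrame₂` ∕ `stepH2Pos_of_e4h2GFrame₂`
(kernel-free) at the frame's Lemma-2.1 datum `(d261, h261)`. [cite: Balaban1985BackgroundPropagators, (3.43)–(3.45) p.398 + Thm 3.3 p.399 + Thm 3.4 p.400] -/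
def SectBFrame₇.toSectBFrame₆ {GA : ∀ i, B9.KernelFamily (geo i) (bg i)} {Cinv : ∀ i, B9.SiteKernel (geo i) (bg i)}
    {IsAnalyticExt : ∀ i, B9.KernelFamily (geo i) (bg i) → (bg i).Cfg → ℝ → Prop}
    (F : SectBFrame₇ c35 geo bg Gp b κ S GA Cinv IsAnalyticExt) : SectBFrame₆ c35 geo bg Gp b κ S GA Cinv IsAnalyticExt :=
  { F with stepH1G := stepH1Pos_of_h1GFrame₂ F.toH1GFrame₂ F.d261 F.h261,
           stepE4G := stepE4Pos_of_e4h2GFrame₂ F.toE4H2GFrame₂ F.d261 F.h261,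
           stepH2G := stepH2Pos_of_e4h2GFrame₂ F.toE4H2GFrame₂ F.d261 F.h261 }

/-- ★★ **ROW 13's `hB` IN ONE INSTANTIATION (v7)**: every `SectBFrame₇`, with the model signs of the readings and Theorems 3.2 ∕ 3.3 of the leaf, yields
`B9.SectBStepPrinted F.dB c35 geo bg Gp GA Cinv IsAnalyticExt` — `B9SectBStepFrameV6.sectBStepPrinted_of_sectBFrame₆` on `toSectBFrame₆`; all twenty block-steps
of Sect. B (G′(U′U) and G(U′U): (3.42)–(3.48), analyticity) are theorems on the letters; NO step displayed.  Honest scope: the frame is NOT shown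
inhabited; nothing of Sect. B is asserted beyond what the tree's theorems prove.
[cite: Balaban1985BackgroundPropagators, Thm 3.4 p.400 + Sect. B pp.400–407 + Thms 3.1–3.3 pp.397–399] -/
theorem sectBStepPrinted_of_sectBFrame₇ {GA : ∀ i, B9.KernelFamily (geo i) (bg i)} {Cinv : ∀ i, B9.SiteKernel (geo i) (bg i)}
    {IsAnalyticExt : ∀ i, B9.KernelFamily (geo i) (bg i) → (bg i).Cfg → ℝ → Prop}
    (F : SectBFrame₇ c35 geo bg Gp b κ S GA Cinv IsAnalyticExt)
    {P : ∀ i, (geo i).Loc → Prop} (Sg : ∀ i, B9FromB6ModelSignsOn.ModelSignsOn (geo i) (P i))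
    (h32 : B9.Thm32Printed F.dB c35 geo bg Cinv) (h33 : B9.Thm33Printed c35 geo bg Gp GA) :
    B9.SectBStepPrinted F.dB c35 geo bg Gp GA Cinv IsAnalyticExt :=
  sectBStepPrinted_of_sectBFrame₆ F.toSectBFrame₆ Sg h32 h33

end Literature.MathematicalPhysics.QuantumFieldTheory.Balaban1983to89.B9SectBStepFrameV7
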